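/-
Copyright: the b2b-balaban cell (near-miss cell 7), T⁴-continuum fan-out, lineage t4-ne7b-p3 (node U5c LARGE-DEVIATION
member P3).  Released under the licence of the surrounding project.
-/
import Summits.QuantumFields.BalabanUV.T4Continuum.Support.SpaceTimeRealisedDomains

/-!
# Space-time Peierls ∕ Cramér route for NE7b — THE ADAPTER TO THE ROW OWNER's H3 CARRIER ALONG THE RUN's OWN
# EXPONENTS: the tagged flow END's binder from `RealisedDomainsR` + typed flow facts + readings, nothing else

Summits-side support leaf of the T⁴-continuum cell (rung (B)+1 on a FINITE torus only; NOT infinite volume, NOT the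
mass gap, NOT the Clay statement; NOT a proof of the spine estimate NE7b).  Lineage `t4-ne7b-p3` (generation 3), node
U5c, skeleton `t4/skeletons/NE7b-t4-ne7b-p3.md` §14.  [folklore] plumbing over `SpaceTimeRealisedDomains`
(`RLin.ofDomains`, `lineageReadingsT_ofDomains`), `SpaceTimeRealisedFlow` ∕ `SpaceTimeLevels` (`extExp`,
`ratio_extExp_eq`, `levelOf_mono'`, `levelOf_jump`, `dropCtl_extExp`) and the COUNT swarm's `HistoryLevelsFlow`
(`expOf`, `expOf_succ_le`, `dropCtl_expOf`), `HistoryRealiseCellsRun.RealisedDomainsR` — all BY NAME; nothing printed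
is asserted; no `[cite:]` tag.

WHAT.  `extExp_extExp`, `levelOf_extExp`, `levelOf_le_cutoff_of_flow` (the side condition `hℓK` of `ofDomains` from the
flow), and **`RLin.runReadingsFlowT_ofDomains`**: for the owner's structure
`H : RealisedDomainsR L s n K₀ R T ped cellP liveC Z` whose profile at the run `K ≥ K₀` is the run's size exponents
frozen at `K` (`s K = extExp (expOf L (R K)) K` — the owner's `HistoryAssemblyRealiseRun.runProfile L R K` satisfies
it by `rfl`), a cutoff `Kc ≥ K`, the run's typed flow facts and readings (i) (ii′) (iii′) (v″) (vi), the binder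
`RunReadingsFlowT … K t` of `SpaceTimeAssemblyT.exists_irThresholdT_relWeightBound` holds — the level data come from
the flow, the histories' timing ∕ freshness ∕ `SkelOK` from the geometry (tagged road).

HONEST DEPENDENCY (cell, verbatim): continuum YM on T⁴ ⇐ BetaPertH ∧ nine spine estimates (0/9 proved); BetaPertH ⇐
(D1) ∧ (D4) ∧ CAP+tail; G-an2-4 gates asym, D1 and NE2/3/4.  This file changes none of it.
-/

open Finset

namespace Summit.QuantumFields.BalabanUV.T4Continuum.SpaceTimePeierls

open Literature.MathematicalPhysics.QuantumFieldTheory.Balaban1983to89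
open Literature.MathematicalPhysics.QuantumFieldTheory.Balaban1983to89.B13ScaleTransfer
open Literature.MathematicalPhysics.QuantumFieldTheory.Balaban1983to89.B16SProfile
open T4PersistenceDictionary T4BankedInduction T4PrintedShapeBanking
open T4TaggedShapeBanking (dictWT costT)
open Summit.QuantumFields.BalabanUV.T4Continuum.ZoneTorus
open Summit.QuantumFields.BalabanUV.T4Continuum.HistoryZones (levelOf)
open Summit.QuantumFields.BalabanUV.T4Continuum.HistoryGen
open Summit.QuantumFields.BalabanUV.T4Continuum.HistoryAdmissible
open Summit.QuantumFields.BalabanUV.T4Continuum.HistoryRealise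
open Summit.QuantumFields.BalabanUV.T4Continuum.HistoryRealiseCellsRun (RealisedDomainsR)
open SpaceTimePeierlsLeaves

noncomputable section

open Classical

namespace RLin

variable {d n L K₀ : ℕ} {ι α π : Type*} [DecidableEq ι] [DecidableEq α]
  {s : ℕ → ℕ → ℕ} {R : ℕ → ℕ → ℕ} {T : ℕ → Finset ι} {ped : ℕ → ι → Pedigree α π}
  {cellP : ℕ → ι → π → Pt d × Finset (Pt d)} {liveC : ℕ → ι → Finset α} {Z : ℕ → ι → α → Finset (Pt d)}

/-! ## §2 Along the run's own exponents: the tagged flow END's binder from `RealisedDomainsR` and typed flow facts -/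

section RunProfile

open Summit.QuantumFields.BalabanUV.T4Continuum.HistoryZones (expOf expOf_succ_le dropCtl_expOf levelOf_of_le
  levelOf_of_ge)

/-- freezing twice is freezing once [folklore] -/
theorem extExp_extExp (σ : ℕ → ℕ) (K : ℕ) : extExp (extExp σ K) K = extExp σ K := by
  funext u
  simp [extExp]

/-- the model scale of the frozen exponents is that of the exponents [folklore] -/
theorem levelOf_extExp (σ : ℕ → ℕ) (K u : ℕ) : levelOf (extExp σ K) K u = levelOf σ K u := by
  rcases Nat.lt_or_ge u K with h | h
  · rw [levelOf_of_le h.le, levelOf_of_le h.le, extExp_of_le h.le, extExp_of_le le_rfl]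
  · rw [levelOf_of_ge h, levelOf_of_ge h]

/-- **THE LEVELS FIT IN THE TORUS, FROM THE FLOW**: the side condition `hℓK` of `RLin.ofDomains` along the run's own
exponents frozen at `K` — from (2.5), the interval with monotone couplings, (2.7) at the size exponent and the located
smallness (`SpaceTimeLevels.levelOf_le_cutoff`). [folklore] -/
theorem levelOf_le_cutoff_of_flow {L K Kc r : ℕ} {s : ℕ → ℕ → ℕ} {R : ℕ → ℕ → ℕ} {g : ℕ → ℝ} {γ β' β₀ : ℝ}
    (hsK : s K = extExp (expOf L (R K)) K) (hL : 4 ≤ L) (hI : Step.InInterval γ Kc g) (hγ1 : γ ≤ 1)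
    (hgmono : ∀ u, u < Kc → g u ≤ g (u + 1)) (h27r : B14.FlowIneq27 g β' β₀ r Kc)
    (hRj : ∀ u, u ≤ Kc → B14.IsRj L r (g u) (R K u))
    (hΘ : ∀ m u, m < u → u ≤ Kc → (1 + (g u) ^ 2 * β' * ((u : ℝ) - m)) ^ β₀ ≤ (L : ℝ) ^ (max (u - m) 2 / 2))
    (hKc : K ≤ Kc) : ∀ u, u ≤ K → levelOf (s K) K u ≤ K := by
  have hL2 : 2 ≤ L := by omega
  have hsKc : ∀ u, u < Kc → expOf L (R K) (u + 1) ≤ expOf L (R K) u :=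
    expOf_succ_le hL2 hRj (fun u hu => (hI u hu).1) (fun u hu => (hI u hu).2.trans hγ1) hgmono
  have hdropKc : DropCtl (expOf L (R K)) Kc := dropCtl_expOf hL2 hI hγ1 hRj h27r hΘ
  have hs : ∀ u, u < K → expOf L (R K) (u + 1) ≤ expOf L (R K) u := fun u hu => hsKc u (lt_of_lt_of_le hu hKc)
  have hdropK : DropCtl (expOf L (R K)) K := fun i k hik hk => hdropKc i k hik (hk.trans hKc)
  intro u hu
  rw [hsK, levelOf_extExp]
  exact levelOf_le_cutoff hs hdropK u hu

/-- **THE TAGGED FLOW END's BINDER FROM THE OWNER's REALISED READING ALONG THE RUN's OWN EXPONENTS.**  For the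
owner's structure `H : RealisedDomainsR L s n K₀ R T ped cellP liveC Z` (field `real` only) whose profile at the run
`K ≥ K₀` is the run's size exponents frozen at `K` — `s K = extExp (expOf L (R K)) K`, which the owner's
`HistoryAssemblyRealiseRun.runProfile L R K` satisfies by `rfl` —, a cutoff `Kc ≥ K`, the run's TYPED FLOW FACTS
((2.7) at `p₀` and at `r`, (2.9), (2.5) for the sizes `R K`, the interval with monotone couplings, the located
smallness of the drop control, `1 ≤ log g⁻²`, the infrared value), and readings (i) (ii′) (iii′) (v″) (vi):
`RunReadingsFlowT … K t` — the binder of `SpaceTimeAssemblyT.exists_irThresholdT_relWeightBound`.  NO hypothesis on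
the histories beyond the owner's `real`. [folklore] -/
theorem runReadingsFlowT_ofDomains (H : RealisedDomainsR L s n K₀ R T ped cellP liveC Z) {K : ℕ} (hK : K₀ ≤ K)
    (hsK : s K = extExp (expOf L (R K)) K) {hN : 0 < n * L ^ K} {hℓK : ∀ u, u ≤ K → levelOf (s K) K u ≤ K}
    {C : T4PrintedShapeBanking.Consts} {r : ℕ} {γ β₀ x₀ β' : ℝ} {X : ℕ → ℝ → ι → ℝ} {Bad : ℕ → ℝ → Finset ι}
    {xup : ℕ → ℝ → ℝ} {jstar : ℕ → ℕ} {c₃ : ℝ} {t : ℝ} {Kc : ℕ} {g : ℕ → ℝ}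
    {rest : Finset (STCellV d n L K K (levelOf (s K) K)) → ι → ℝ}
    -- the typed flow facts of run `K`
    (hI : Step.InInterval γ Kc g) (hγ1 : γ ≤ 1) (hgmono : ∀ u, u < Kc → g u ≤ g (u + 1))
    (h27 : B14.FlowIneq27 g β' β₀ C.p₀ Kc) (h27r : B14.FlowIneq27 g β' β₀ r Kc)
    (h29 : B14FlowStep.FlowIneq29 (R K) g L β' β₀ Kc) (hRj : ∀ u, u ≤ Kc → B14.IsRj L r (g u) (R K u))
    (hΘ : ∀ m u, m < u → u ≤ Kc → (1 + (g u) ^ 2 * β' * ((u : ℝ) - m)) ^ β₀ ≤ (L : ℝ) ^ (max (u - m) 2 / 2))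
    (hx1 : ∀ u, u ≤ Kc → 1 ≤ Real.log ((g u) ^ 2)⁻¹) (hxK : x₀ ≤ Real.log ((g Kc) ^ 2)⁻¹)
    -- side conditions and readings
    (hn : 0 < n) (hL : 4 ≤ L) (hR : ∀ t, 1 ≤ R K t) (hn₁ : 13 ≤ C.n₁) (hKc : K ≤ Kc)
    (hnonneg : ∀ τ ∈ T K, 0 ≤ X K t τ) (hBad : Bad K t ⊆ T K) (hjlo : jstar K ≤ K)
    (hold : ∀ τ ∈ Bad K t, ∃ c ∈ liveC K τ, ((ped K τ).toPGen (cellP K τ) c).rootStep ≤ jstar K)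
    (hsep : (ofDomains s T ped cellP liveC Z K hN hℓK).LatSepT)
    (hfac : ∀ (𝒦 : Finset (STCellV d n L K K (levelOf (s K) K))), ∀ τ ∈ T K,
      (ofDomains s T ped cellP liveC Z K hN hℓK).toLinDataT.model.IsContour τ 𝒦 → ∀ c ∈ liveC K τ,
      (∀ x ∈ 𝒦, (ofDomains s T ped cellP liveC Z K hN hℓK).toLinDataT.InLin (τ, c) x) →
        X K t τ ≤ Real.exp (-(credits (credit C g ∘ Prod.snd) (toGenT 0 ((ped K τ).toPGen (cellP K τ) c)) -
          lifeCost (dictWT Prod.snd (R K) C.n₁) (costT Prod.snd C Kc (R K))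
            (toGenT 0 ((ped K τ).toPGen (cellP K τ) c)))) * rest 𝒦 τ)
    (hrest0 : ∀ (𝒦 : Finset (STCellV d n L K K (levelOf (s K) K))), ∀ τ ∈ T K, 0 ≤ rest 𝒦 τ)
    (hrest : ∀ (𝒦 : Finset (STCellV d n L K K (levelOf (s K) K))),
      ∑ τ ∈ (ofDomains s T ped cellP liveC Z K hN hℓK).toLinDataT.model.T.filter
          (fun τ => (ofDomains s T ped cellP liveC Z K hN hℓK).toLinDataT.model.IsContour τ 𝒦),
          rest 𝒦 τ ≤ Real.exp c₃ ^ 𝒦.card * xup K t) :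
    RunReadingsFlowT C L r β₀ x₀ T X Bad xup jstar ((((3 ^ d + L ^ (2 * d) + 1 : ℕ) : ℝ) + 1) ^ 2)
      (((n * L ^ (K - levelOf (s K) K K)) ^ d : ℕ) : ℝ) (8 * 126 ^ d) (126 ^ d) ((127 : ℝ) ^ d + 3) c₃ K t := by
  have hL2 : 2 ≤ L := by omega
  -- the two level facts of the run's exponents, restricted to `K`, then read on the frozen profile `s K`
  have hsKc : ∀ u, u < Kc → expOf L (R K) (u + 1) ≤ expOf L (R K) u :=
    expOf_succ_le hL2 hRj (fun u hu => (hI u hu).1) (fun u hu => (hI u hu).2.trans hγ1) hgmono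
  have hdropKc : DropCtl (expOf L (R K)) Kc := dropCtl_expOf hL2 hI hγ1 hRj h27r hΘ
  have hs : ∀ u, u < K → expOf L (R K) (u + 1) ≤ expOf L (R K) u := fun u hu => hsKc u (lt_of_lt_of_le hu hKc)
  have hdropK : DropCtl (expOf L (R K)) K := fun i k hik hk => hdropKc i k hik (hk.trans hKc)
  have hdrop' : ∀ m, DropCtl (s K) m := fun m => by rw [hsK]; exact dropCtl_extExp hdropK m
  have hmono : ∀ u, levelOf (s K) K u ≤ levelOf (s K) K (u + 1) := fun u => by
    rw [hsK, levelOf_extExp, levelOf_extExp]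
    exact levelOf_mono' hs hdropK u
  have hjump : ∀ u, levelOf (s K) K (u + 1) ≤ levelOf (s K) K u + 2 := fun u => by
    rw [hsK, levelOf_extExp, levelOf_extExp]
    exact levelOf_jump hs hdropK u
  have hqℓ : ∀ u, ratio L (ofDomains s T ped cellP liveC Z K hN hℓK).s u =
      L ^ (levelOf (s K) K (u + 1) - levelOf (s K) K u) := by
    intro u
    show ratio L (s K) u = _
    rw [hsK, levelOf_extExp, levelOf_extExp]
    exact ratio_extExp_eq hs hdropK L u
  exact ⟨STCellV d n L K K (levelOf (s K) K), inferInstance, inferInstance,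
    (ofDomains s T ped cellP liveC Z K hN hℓK).toLinDataT.model, inferInstance, 3 ^ d + L ^ (2 * d) + 1, Kc, R K, g, β',
    rfl, h27, h29, hRj, hx1, hxK,
    lineageReadingsT_ofDomains H hK hn hL hmono hjump hqℓ hdrop' hR hn₁ hKc hnonneg hBad hjlo hold hsep hfac hrest0
      hrest⟩

end RunProfile

end RLin

end

end Summit.QuantumFields.BalabanUV.T4Continuum.SpaceTimePeierls
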